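import Summits.MatrixMultiplication.MatrixMultiplication.Theses.SnSubsetDichotomy
import Summits.MatrixMultiplication.MatrixMultiplication.Theorems.SnSubsetDichotomyThresholdSubsetTriplesChainDefs

/-!
# `ThresholdSubsetTriples` (crux stmt-MatrixMultiplication-10882, route `SnSubsetDichotomy`) —
# negative-side support VII: line `interleaved-subsignature-ascent` — what is load-bearing in `stub_design`,
# and the level rule (refuter cdisprove gen 2)

Definition-free copy of §7 of the crux workfile `Cruxes/ThresholdSubsetTriples/Disproof.lean` (v5), about the
skeleton `Cruxes/ThresholdSubsetTriples/Lines/interleaved_subsignature_ascent.lean` (open stub `stub_design` =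
`X` on chain classes; declared dead by its lead, `Lines/interleaved-subsignature-ascent-dead.md`).
Sorry-free content: `stubDesign_holds_without_levelCondition` (drop `LevelCondition` from `stub_design`, keep
everything else verbatim: the FULL systems `D k = {0,…,k}` pass at every scale — so `LevelCondition` and
`0 < c` are the stub's only load-bearing conjuncts; the `c = 0` case is the skeleton's
`design_false_at_scale_zero`), `levelCondition_eq_of_mem_inter₁₂ / ₂₃ / ₁₃` and
`levelCondition_card_add_card_add_card_le` (the level-local content of `LevelCondition`: two direction sets
share at most one direction, hence at most `k + 4` letters at level `k` — capacity `((k+4)/3)³ ≫ (k+1)^{3/2}`,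
so single levels are not the obstruction; cf. lead censuses c3a–c3d).

Sources: the line skeleton and `…Theorems.SnSubsetDichotomyThresholdSubsetTriplesChainDefs` (p96122) for
`starPiece` / `LevelCondition` / `IsDirectionSystem`; Cohn–Umans 2003 Def. 2.1; folklore (Fisher–Yates).
-/

noncomputable section

set_option linter.dupNamespace false
set_option autoImplicit false

open scoped BigOperators Pointwise

namespace Summit.MatrixMultiplication.MatrixMultiplication.Theorems.ThresholdSubsetTriples.Negative

open Summit.MatrixMultiplication.MatrixMultiplication.Theses.SnSubsetDichotomy
open Summit.MatrixMultiplication.MatrixMultiplication.Theorems.ThresholdSubsetTriples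
open Literature.Combinatorics.Additive

/-! ## §7 Line `interleaved-subsignature-ascent` — load-bearing analysis of `stub_design` -/

section Interleaved

/-- The FULL direction system `D k = {0, …, k}` (chain class `= S_{n+1}`). -/
theorem isDirectionSystem_Iic (n : ℕ) : IsDirectionSystem (fun k : Fin (n + 1) => Finset.Iic k) :=
  fun _ _ hd => Finset.mem_Iic.1 hd

/-- Its level volumes multiply to `(n+1)!`. -/
theorem prod_card_Iic (n : ℕ) : ∏ k : Fin (n + 1), (Finset.Iic k).card = (n + 1).factorial := by
  simp_rw [Fin.card_Iic]
  rw [Fin.prod_univ_eq_prod_range (fun i => i + 1) (n + 1), Finset.prod_range_add_one_eq_factorial]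

/-- **`LevelCondition` is the only load-bearing conjunct of `stub_design` besides `0 < c`**: with it
dropped (everything else verbatim) the three FULL systems (`S_D = S_{n+1}`, level volumes `((n+1)!)³`)
satisfy the stub at every scale. -/
theorem stubDesign_holds_without_levelCondition :
    ∀ c : ℝ, 0 < c → ∀ n₀ : ℕ, ∃ n ≥ n₀, ∃ DA DB DC : Fin (n + 1) → Finset (Fin (n + 1)),
      IsDirectionSystem DA ∧ IsDirectionSystem DB ∧ IsDirectionSystem DC ∧
      ((n + 1).factorial : ℝ) ^ ((3 : ℝ) / 2) * Real.exp (-(c * Real.sqrt ((n + 1 : ℕ) : ℝ))) <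
        ((∏ k : Fin (n + 1), ((DA k).card * (DB k).card * (DC k).card) : ℕ) : ℝ) := by
  intro c hc n₀
  refine ⟨n₀, le_rfl, fun k => Finset.Iic k, fun k => Finset.Iic k, fun k => Finset.Iic k,
    isDirectionSystem_Iic n₀, isDirectionSystem_Iic n₀, isDirectionSystem_Iic n₀, ?_⟩
  have hprod : (∏ k : Fin (n₀ + 1), ((Finset.Iic k).card * (Finset.Iic k).card * (Finset.Iic k).card))
      = (n₀ + 1).factorial ^ 3 := by
    rw [← prod_card_Iic n₀, ← Finset.prod_pow]
    refine Finset.prod_congr rfl fun k _ => by ring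
  rw [hprod]
  set F : ℝ := ((n₀ + 1).factorial : ℝ) with hF
  have hF1 : (1 : ℝ) ≤ F := by rw [hF]; exact_mod_cast Nat.succ_le_of_lt (Nat.factorial_pos _)
  have hexp : Real.exp (-(c * Real.sqrt ((n₀ + 1 : ℕ) : ℝ))) < 1 := by
    rw [Real.exp_lt_one_iff, neg_lt_zero]
    exact mul_pos hc (Real.sqrt_pos.2 (by positivity))
  have hpow : F ^ ((3 : ℝ) / 2) ≤ F ^ (3 : ℝ) := Real.rpow_le_rpow_of_exponent_le hF1 (by norm_num)
  calc F ^ ((3 : ℝ) / 2) * Real.exp (-(c * Real.sqrt ((n₀ + 1 : ℕ) : ℝ)))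
      < F ^ ((3 : ℝ) / 2) * 1 := mul_lt_mul_of_pos_left hexp (by positivity)
    _ ≤ F ^ (3 : ℝ) := by rw [mul_one]; exact hpow
    _ = (((n₀ + 1).factorial ^ 3 : ℕ) : ℝ) := by
        rw [show (3 : ℝ) = ((3 : ℕ) : ℝ) by norm_num, Real.rpow_natCast]
        push_cast
        rfl

variable {α : Type*} [DecidableEq α]

/-- **Level rule (L), pair `(1,2)`.**  Under `LevelCondition` (all three lower sets non-empty, `E₃ ≠ ∅`)
two direction sets share AT MOST ONE direction: `x ≠ y ∈ E₁ ∩ E₂` gives the non-trivial relation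
`(x t)(y t)·(y t)(x t)·(e t)(e t) = 1` with trivial lower quotients. -/
theorem levelCondition_eq_of_mem_inter₁₂ {t : α} {E₁ E₂ E₃ : Finset α} {L₁ L₂ L₃ : Finset (Equiv.Perm α)}
    (h : LevelCondition t E₁ E₂ E₃ L₁ L₂ L₃) (h₃ : E₃.Nonempty) (hL₁ : L₁.Nonempty) (hL₂ : L₂.Nonempty)
    (hL₃ : L₃.Nonempty) {x y : α} (hx₁ : x ∈ E₁) (hx₂ : x ∈ E₂) (hy₁ : y ∈ E₁) (hy₂ : y ∈ E₂) :
    x = y := by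
  obtain ⟨e, he⟩ := h₃
  obtain ⟨a, ha⟩ := hL₁
  obtain ⟨b, hb⟩ := hL₂
  obtain ⟨c, hc⟩ := hL₃
  have key := h x hx₁ y hy₁ y hy₂ x hx₂ e he e he a ha a ha b hb b hb c hc c hc (by
    simp only [mul_inv_cancel, mul_one, Equiv.Perm.one_apply, Equiv.mul_swap_mul_self,
      Equiv.swap_mul_self])
  exact key.1.1

/-- Level rule (L), pair `(2,3)`. -/
theorem levelCondition_eq_of_mem_inter₂₃ {t : α} {E₁ E₂ E₃ : Finset α} {L₁ L₂ L₃ : Finset (Equiv.Perm α)}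
    (h : LevelCondition t E₁ E₂ E₃ L₁ L₂ L₃) (h₁ : E₁.Nonempty) (hL₁ : L₁.Nonempty) (hL₂ : L₂.Nonempty)
    (hL₃ : L₃.Nonempty) {x y : α} (hx₂ : x ∈ E₂) (hx₃ : x ∈ E₃) (hy₂ : y ∈ E₂) (hy₃ : y ∈ E₃) :
    x = y := by
  obtain ⟨e, he⟩ := h₁
  obtain ⟨a, ha⟩ := hL₁
  obtain ⟨b, hb⟩ := hL₂
  obtain ⟨c, hc⟩ := hL₃
  have key := h e he e he x hx₂ y hy₂ y hy₃ x hx₃ a ha a ha b hb b hb c hc c hc (by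
    simp only [mul_inv_cancel, one_mul, mul_one, Equiv.Perm.one_apply, Equiv.mul_swap_mul_self,
      Equiv.swap_mul_self])
  exact key.2.1.1

/-- Level rule (L), pair `(1,3)`. -/
theorem levelCondition_eq_of_mem_inter₁₃ {t : α} {E₁ E₂ E₃ : Finset α} {L₁ L₂ L₃ : Finset (Equiv.Perm α)}
    (h : LevelCondition t E₁ E₂ E₃ L₁ L₂ L₃) (h₂ : E₂.Nonempty) (hL₁ : L₁.Nonempty) (hL₂ : L₂.Nonempty)
    (hL₃ : L₃.Nonempty) {x y : α} (hx₁ : x ∈ E₁) (hx₃ : x ∈ E₃) (hy₁ : y ∈ E₁) (hy₃ : y ∈ E₃) :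
    x = y := by
  obtain ⟨e, he⟩ := h₂
  obtain ⟨a, ha⟩ := hL₁
  obtain ⟨b, hb⟩ := hL₂
  obtain ⟨c, hc⟩ := hL₃
  have key := h x hx₁ y hy₁ e he e he y hy₃ x hx₃ a ha a ha b hb b hb c hc c hc (by
    simp only [mul_inv_cancel, mul_one, Equiv.Perm.one_apply, Equiv.mul_swap_mul_self,
      Equiv.swap_mul_self])
  exact key.1.1

/-- **Level rule (L), counted**: the three direction sets of a level passing `LevelCondition` have
pairwise intersections of size `≤ 1`, hence `|E₁| + |E₂| + |E₃| ≤ |E₁ ∪ E₂ ∪ E₃| + 3` — at level `k` of a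
direction system (`E_i ⊆ {0,…,k}`) at most `k + 4` letters in total, level volume `≤ ((k+4)/3)³`.  This is
the whole level-local content; it does not bound `GM(η_k)` away from `1` (level capacity `≫ (k+1)^{3/2}`,
lead census c3b §4). -/
theorem levelCondition_card_add_card_add_card_le {t : α} {E₁ E₂ E₃ : Finset α}
    {L₁ L₂ L₃ : Finset (Equiv.Perm α)} (h : LevelCondition t E₁ E₂ E₃ L₁ L₂ L₃) (h₁ : E₁.Nonempty)
    (h₂ : E₂.Nonempty) (h₃ : E₃.Nonempty) (hL₁ : L₁.Nonempty) (hL₂ : L₂.Nonempty) (hL₃ : L₃.Nonempty) :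
    E₁.card + E₂.card + E₃.card ≤ (E₁ ∪ E₂ ∪ E₃).card + 3 := by
  have h12 : (E₁ ∩ E₂).card ≤ 1 := Finset.card_le_one.2 fun x hx y hy =>
    levelCondition_eq_of_mem_inter₁₂ h h₃ hL₁ hL₂ hL₃ (Finset.mem_inter.1 hx).1 (Finset.mem_inter.1 hx).2
      (Finset.mem_inter.1 hy).1 (Finset.mem_inter.1 hy).2
  have h13 : (E₁ ∩ E₃).card ≤ 1 := Finset.card_le_one.2 fun x hx y hy =>
    levelCondition_eq_of_mem_inter₁₃ h h₂ hL₁ hL₂ hL₃ (Finset.mem_inter.1 hx).1 (Finset.mem_inter.1 hx).2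
      (Finset.mem_inter.1 hy).1 (Finset.mem_inter.1 hy).2
  have h23 : (E₂ ∩ E₃).card ≤ 1 := Finset.card_le_one.2 fun x hx y hy =>
    levelCondition_eq_of_mem_inter₂₃ h h₁ hL₁ hL₂ hL₃ (Finset.mem_inter.1 hx).1 (Finset.mem_inter.1 hx).2
      (Finset.mem_inter.1 hy).1 (Finset.mem_inter.1 hy).2
  have hA := Finset.card_union_add_card_inter E₁ E₂
  have hB := Finset.card_union_add_card_inter (E₁ ∪ E₂) E₃
  have hC : ((E₁ ∪ E₂) ∩ E₃).card ≤ 2 := by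
    calc ((E₁ ∪ E₂) ∩ E₃).card = ((E₁ ∩ E₃) ∪ (E₂ ∩ E₃)).card := by rw [Finset.union_inter_distrib_right]
      _ ≤ (E₁ ∩ E₃).card + (E₂ ∩ E₃).card := Finset.card_union_le _ _
      _ ≤ 2 := by omega
  omega

end Interleaved


end Summit.MatrixMultiplication.MatrixMultiplication.Theorems.ThresholdSubsetTriples.Negative

end
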